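import Mathlib
import HarnessLib
import Summits.AtomisticToContinuum.FouriersLaw.Theses.BondHeatUncertainty
import Literature.MathematicalPhysics.KineticTheory.FouriersLaw
import Literature.MathematicalPhysics.KineticTheory.LangevinChainKernel
import Literature.MathematicalPhysics.KineticTheory.LangevinChainGibbs

/-!
# Sketch — first lemmas of the crux ideas for `LinearResponseFTUR` (stmt-AtomisticToContinuum-9122)

Planner folder file (crux-ideate round 1, ideator 1). Two levers, stated over existing declarations only
(no new definitions land from here); the `C`, `V` lets are copied VERBATIM from the crux so that the
transfer theorem at the end is pure logic.

* `LinearScoreCauchySchwarz` — idea `linear-score-cauchy-schwarz`: the δ → 0 polarisation of the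
  fluctuation-theorem uncertainty relation is Cauchy–Schwarz, on the EQUILIBRIUM stationary process, between
  the bond heat `Q_t` and the explicit linear score `S_t = Q_t/T² + W(Θ x_t) - W(x_0)`, where `W` solves
  the flipped Poisson equation `(Θ L Θ) W = j_b / T²` at equal temperatures. First lemma = the pure
  equilibrium inequality `2 g² t² ≤ V_N(b,t) (g t / T² + k)` with `g = -⟨j_b, W⟩_{μ_T}` (Green–Kubo value)
  and `k = ½ ‖W - W∘Θ‖²_{μ_T}`; NESS links `GreenKuboCorrectorForm` (`D_N/(N-1) = g`) and
  `SnapshotKLLowerBound` (`K ≥ k`, Donsker–Varadhan with odd test functions); `FlippedPoissonCorrector`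
  (existence of `W`); and the CHECKED transfer `cardA_transfer : … → LinearResponseFTUR`.
* `CountingFieldDetailedBalance` — idea `counting-field-detailed-balance`: adjoining the bond charge
  `Q = ∫₀ᵗ j_b` makes the two-temperature chain Θ-reversible with respect to the local-equilibrium weight
  tilted by the counting field, `exp(-H_{≤b}/T_L - H_{>b}/T_R - (1/T_L - 1/T_R) Q)`: a ONE-STEP kernel
  identity (local detailed balance without path space), to which the vendored fact
  `Literature.Probability.Entropy.HasegawaVanVu2019_FTUR` applies verbatim on `PhaseSpace² × ℝ`.
-/

namespace Summit.AtomisticToContinuum.FouriersLaw.Cruxes.LinearResponseFTUR.SketchIdeator1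

open MeasureTheory ProbabilityTheory Filter Topology
open scoped NNReal ENNReal ContDiff
open Literature.MathematicalPhysics.KineticTheory.HeatConduction Literature.Probability.Process

/-- **Card `linear-score-cauchy-schwarz`, first lemma (pure equilibrium, fixed `N`).**
For the pinned chain at ONE temperature `T` and a bond `b`, let `W` be a smooth solution, with
`e^{θH}`-bounded derivatives up to order 2 for some `θ < 1/(2T)` (so `W ∈ L²(μ_T)`), of the flipped Poisson
equation `(Θ L_T Θ) W = j_b / T²` (`Θ(q,p) = (q,-p)`; `Θ L Θ` is the `L²(μ_T)`-adjoint of the equilibrium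
generator). Put `g := -∫ j_b W dμ_T` and `k := ½ ∫ (W - W∘Θ)² dμ_T`. Then `g ≥ 0` (it is `T²` times the
bath Dirichlet energy of `W`), `V_N(b,t) ≥ 0` (a variance) and, with `V_N(b,t) = 2∫₀ᵗ (t-s) ⟨j_b, P_s j_b⟩ ds`
EXACTLY as in the crux, `2 g² t² ≤ V_N(b,t) · (g t / T² + k)` for every `t > 0`.
Mechanism: with `U := W∘Θ` one has `L U = -j_b/T²`, and on the stationary equilibrium process
`S_t := Q_t/T² + U(x_t) - W(x_0)` satisfies `⟨Q_t, S_t⟩ = 2 g t` and `½‖S_t‖² = k + g t/T²`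
(semigroup calculus using only `ΘLΘ W = j_b/T²` and `P_s^† = Θ P_s Θ`), so the claim is Cauchy–Schwarz.
Exact check on the harmonic member (planner folder `checks/`): `g = G_N`, `k = K_N` (= 1/6, 2/9 at N = 2). -/
def LinearScoreCauchySchwarz : Prop :=
  ∀ ω₂ lam β γ : ℝ, 0 < ω₂ → 0 < lam → 0 < β → 0 < γ → ∀ T : ℝ, 0 < T →
    (let P := pinnedChain ω₂ lam β γ
     let C : ℕ → ℕ → ℝ → ℝ := fun N b s => if h : b < N then ∫ z, P.bondCurrent N ⟨b, h⟩ z * (∫ y, P.bondCurrent N ⟨b, h⟩ y ∂(P.transitionKernel N T T s.toNNReal z)) ∂(P.gibbsMeasure N T) else 0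
     let V : ℕ → ℕ → ℝ → ℝ := fun N b t => 2 * ∫ s in (0 : ℝ)..t, (t - s) * C N b s
     ∀ N : ℕ, 2 ≤ N → ∀ b : ℕ, b + 1 < N →
     let j : PhaseSpace N → ℝ := fun x => if h : b < N then P.bondCurrent N ⟨b, h⟩ x else 0
     ∀ W : PhaseSpace N → ℝ, ContDiff ℝ ∞ W →
       (∃ θ A : ℝ, θ < 1 / (2 * T) ∧ ∀ n : ℕ, n ≤ 2 → ∀ x : PhaseSpace N,
          ‖iteratedFDeriv ℝ n W x‖ ≤ A * Real.exp (θ * P.hamiltonian N x)) →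
       (∀ x : PhaseSpace N,
          P.generator N T T (fun y => W (y.1, -y.2)) (x.1, -x.2) = j x / T ^ 2) →
       let g : ℝ := -∫ x, j x * W x ∂(P.gibbsMeasure N T)
       let k : ℝ := (1 / 2) * ∫ x, (W x - W (x.1, -x.2)) ^ 2 ∂(P.gibbsMeasure N T)
       0 ≤ g ∧ ∀ t : ℝ, 0 < t → 0 ≤ V N b t ∧ 2 * g ^ 2 * t ^ 2 ≤ V N b t * (g * t / T ^ 2 + k))

/-- **Card `linear-score-cauchy-schwarz`, support: existence of the flipped corrector.** The flipped Poisson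
equation `(Θ L_T Θ) W = j_b/T²` has a smooth solution with `e^{θH}`-bounded 2-jet for some `θ < 1/(2T)`
(expected: `W = -(1/T²)∫₀^∞ Θ P_s Θ j_b ds`, from exponential ergodicity of the EQUILIBRIUM chain at fixed
`N` in the `e^{θH}`-weighted norm, CEHR 2018 Thm 2.13(2) at `T_L = T_R`, plus hypoelliptic regularity). -/
def FlippedPoissonCorrector : Prop :=
  ∀ ω₂ lam β γ : ℝ, 0 < ω₂ → 0 < lam → 0 < β → 0 < γ → ∀ T : ℝ, 0 < T →
    (let P := pinnedChain ω₂ lam β γ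
     ∀ N : ℕ, 2 ≤ N → ∀ b : ℕ, b + 1 < N →
     let j : PhaseSpace N → ℝ := fun x => if h : b < N then P.bondCurrent N ⟨b, h⟩ x else 0
     ∃ W : PhaseSpace N → ℝ, ContDiff ℝ ∞ W ∧
       (∃ θ A : ℝ, θ < 1 / (2 * T) ∧ ∀ n : ℕ, n ≤ 2 → ∀ x : PhaseSpace N,
          ‖iteratedFDeriv ℝ n W x‖ ≤ A * Real.exp (θ * P.hamiltonian N x)) ∧
       ∀ x : PhaseSpace N, P.generator N T T (fun y => W (y.1, -y.2)) (x.1, -x.2) = j x / T ^ 2)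

/-- **Card `linear-score-cauchy-schwarz`, NESS link 1: the Green–Kubo / corrector form of the BLR response.**
Under weak-NESS uniqueness, along any steady-state family with response limits `D`, for `N ≥ 2` and every bond
`b`: `D N / (N - 1) = -∫ j_b W dμ_T` for every flipped corrector `W` as above (= `(1/T²)∫₀^∞ C_N(b,s) ds`, the
finite-`N` Green–Kubo formula; proof sketch: test the weak steady-state equation with the `e^{θH}`-weighted
`U = W∘Θ`, `L_T U = -j_b/T²`, use the source identity `pinnedChain_integral_generator_gibbsMeasure` and
`μ_δ → μ_T` from uniqueness + uniform exponential moments; equal bond currents give the sum over bonds). -/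
def GreenKuboCorrectorForm : Prop :=
  ∀ ω₂ lam β γ : ℝ, 0 < ω₂ → 0 < lam → 0 < β → 0 < γ →
    (∀ (N : ℕ) (T_L T_R : ℝ), 0 < T_L → 0 < T_R → ∀ μ ν : Measure (PhaseSpace N),
      (pinnedChain ω₂ lam β γ).IsSteadyState N T_L T_R μ →
      (pinnedChain ω₂ lam β γ).IsSteadyState N T_L T_R ν → μ = ν) →
    ∀ μ : (N : ℕ) → ℝ → ℝ → Measure (PhaseSpace N),
      (∀ (N : ℕ) (T_L T_R : ℝ), 0 < T_L → 0 < T_R →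
        (pinnedChain ω₂ lam β γ).IsSteadyState N T_L T_R (μ N T_L T_R)) →
    ∀ T : ℝ, 0 < T → ∀ D : ℕ → ℝ,
      (∀ N : ℕ, Tendsto (fun δ : ℝ =>
        (pinnedChain ω₂ lam β γ).totalCurrent (μ N (T + δ / 2) (T - δ / 2)) / δ) (𝓝[≠] 0) (𝓝 (D N))) →
    (let P := pinnedChain ω₂ lam β γ
     ∀ N : ℕ, 2 ≤ N → ∀ b : ℕ, b + 1 < N →
     let j : PhaseSpace N → ℝ := fun x => if h : b < N then P.bondCurrent N ⟨b, h⟩ x else 0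
     ∀ W : PhaseSpace N → ℝ, ContDiff ℝ ∞ W →
       (∃ θ A : ℝ, θ < 1 / (2 * T) ∧ ∀ n : ℕ, n ≤ 2 → ∀ x : PhaseSpace N,
          ‖iteratedFDeriv ℝ n W x‖ ≤ A * Real.exp (θ * P.hamiltonian N x)) →
       (∀ x : PhaseSpace N, P.generator N T T (fun y => W (y.1, -y.2)) (x.1, -x.2) = j x / T ^ 2) →
       D N / ((N : ℝ) - 1) = -∫ x, j x * W x ∂(P.gibbsMeasure N T))

/-- **Card `linear-score-cauchy-schwarz`, NESS link 2: the snapshot-KL hypothesis dominates `k`.**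
Under the same hypotheses: if `KL(μ_{N,δ} ‖ Θ_* μ_{N,δ}) ≤ K δ²` eventually as `δ → 0`, then
`½ ∫ (W - W∘Θ)² dμ_T ≤ K` (Donsker–Varadhan / Fenchel lower bound
`Literature.Probability.Divergences.integral_le_toReal_klDiv_add_integral` with the odd bounded test
functions `δ ψ`, `ψ → -(W - W∘Θ)`, and first-order response `⟨ψ⟩_δ = δ⟨ψ, h⟩ + o(δ)`, `h_odd = -(W - W∘Θ)/2`). -/
def SnapshotKLLowerBound : Prop :=
  ∀ ω₂ lam β γ : ℝ, 0 < ω₂ → 0 < lam → 0 < β → 0 < γ →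
    (∀ (N : ℕ) (T_L T_R : ℝ), 0 < T_L → 0 < T_R → ∀ μ ν : Measure (PhaseSpace N),
      (pinnedChain ω₂ lam β γ).IsSteadyState N T_L T_R μ →
      (pinnedChain ω₂ lam β γ).IsSteadyState N T_L T_R ν → μ = ν) →
    ∀ μ : (N : ℕ) → ℝ → ℝ → Measure (PhaseSpace N),
      (∀ (N : ℕ) (T_L T_R : ℝ), 0 < T_L → 0 < T_R →
        (pinnedChain ω₂ lam β γ).IsSteadyState N T_L T_R (μ N T_L T_R)) →
    ∀ T : ℝ, 0 < T →
    (let P := pinnedChain ω₂ lam β γ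
     ∀ N : ℕ, 2 ≤ N → ∀ b : ℕ, b + 1 < N →
     let j : PhaseSpace N → ℝ := fun x => if h : b < N then P.bondCurrent N ⟨b, h⟩ x else 0
     ∀ W : PhaseSpace N → ℝ, ContDiff ℝ ∞ W →
       (∃ θ A : ℝ, θ < 1 / (2 * T) ∧ ∀ n : ℕ, n ≤ 2 → ∀ x : PhaseSpace N,
          ‖iteratedFDeriv ℝ n W x‖ ≤ A * Real.exp (θ * P.hamiltonian N x)) →
       (∀ x : PhaseSpace N, P.generator N T T (fun y => W (y.1, -y.2)) (x.1, -x.2) = j x / T ^ 2) →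
       ∀ K : ℝ, 0 ≤ K →
         (∀ᶠ δ in 𝓝[≠] (0 : ℝ), InformationTheory.klDiv (μ N (T + δ / 2) (T - δ / 2))
            (Measure.map (fun x : PhaseSpace N => (x.1, -x.2)) (μ N (T + δ / 2) (T - δ / 2))) ≤
            ENNReal.ofReal (K * δ ^ 2)) →
         (1 / 2) * ∫ x, (W x - W (x.1, -x.2)) ^ 2 ∂(P.gibbsMeasure N T) ≤ K)

/-- **Card `counting-field-detailed-balance`, first lemma (all `δ`, fixed `N`, no path space).**
Local detailed balance as a ONE-STEP identity for the law of `(x_t, Q_t)`, `Q_t = ∫₀ᵗ j_b(x_s) ds` the charge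
through bond `b`, started from Lebesgue `dx`: for every measurable `F ≥ 0` on `PhaseSpace² × ℝ`,
`∫dx E_x F(x, x_t, Q_t) = ∫dx E_x [F(Θx_t, Θx, -Q_t) · exp(V₂(x_t) - V₂(x) + Q_t (1/T_L - 1/T_R))]`,
`V₂ := H_{≤b}/T_L + H_{>b}/T_R` (site energies with the bond-`b` interaction split half/half, matching the
symmetric current `j_b = -½(p_b+p_{b+1})V'`), i.e. `dM_t/d(ι_*M_t) = exp(s_med)` with the medium entropy
`s_med = -q_L/T_L - q_R/T_R` written through energy balance `q_L = ΔH_{≤b} + Q_t`, `q_R = ΔH_{>b} - Q_t`.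
At `T_L = T_R` it is Θ-detailed balance of the equilibrium kernel w.r.t. Gibbs. Route to a proof WITHOUT
Girsanov: divergence duality of the SDE kernels (in tree, `ConfinedDuality`/`LangevinChainReversal`:
`dx P_t(x,dy) = e^{2γt} dy P̂_t(y,dx)`), pathwise momentum reversal `P̂ = Θ P⁺ Θ` (anti-damped chain), and the
exact Doob conjugation on the charge-extended space `L̃⁺ = e^{-Ṽ} L̃ e^{Ṽ} - 2γ`,
`Ṽ(x,Q) = V₂(x) + (1/T_L - 1/T_R) Q` (generator algebra checked by hand; `L̃ e^{θṼ} ≤ 2θγ e^{θṼ}` for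
`θ ≤ 1` gives the a-priori exponential moment, uniqueness of bounded solutions of the anti-damped Cauchy
problem gives equality). -/
def CountingFieldDetailedBalance : Prop :=
  ∀ ω₂ lam β γ : ℝ, 0 < ω₂ → 0 < lam → 0 < β → 0 < γ → ∀ T_L T_R : ℝ, 0 < T_L → 0 < T_R →
    (let P := pinnedChain ω₂ lam β γ
     ∀ N : ℕ, ∀ b : ℕ, b + 1 < N → ∀ t : ℝ, 0 < t →
     let Θ : PhaseSpace N → PhaseSpace N := fun x => (x.1, -x.2)
     let j : PhaseSpace N → ℝ := fun x => if h : b < N then P.bondCurrent N ⟨b, h⟩ x else 0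
     let Hl : PhaseSpace N → ℝ := fun x =>
       (∑ i : Fin N, if i.val ≤ b then x.2 i ^ 2 / 2 + P.U (x.1 i) else 0) +
         ∑ i : Fin N, ∑ k : Fin N, if k.val = i.val + 1 then
           (if k.val ≤ b then P.V (x.1 k - x.1 i) else if i.val = b then P.V (x.1 k - x.1 i) / 2 else 0)
           else 0
     let V₂ : PhaseSpace N → ℝ := fun x => Hl x / T_L + (P.hamiltonian N x - Hl x) / T_R
     let X : PhaseSpace N → WienerPair → PhaseSpace N := fun x w => P.solMap N T_L T_R t x (pairPath w)
     let Q : PhaseSpace N → WienerPair → ℝ := fun x w =>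
       ∫ s in (0 : ℝ)..t, j (P.solMap N T_L T_R s x (pairPath w))
     ∀ F : PhaseSpace N × PhaseSpace N × ℝ → ℝ≥0∞, Measurable F →
       ∫⁻ x, ∫⁻ w, F (x, X x w, Q x w) ∂wienerPair ∂volume =
         ∫⁻ x, ∫⁻ w, F (Θ (X x w), Θ x, -Q x w) *
           ENNReal.ofReal (Real.exp (V₂ (X x w) - V₂ x + Q x w * (1 / T_L - 1 / T_R))) ∂wienerPair ∂volume)

/-- **Transfer of card `linear-score-cauchy-schwarz` (kernel-checked): C⁺ ⇒ the crux, by instantiation and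
monotonicity in `K`.** -/
theorem cardA_transfer (hW : FlippedPoissonCorrector) (hCS : LinearScoreCauchySchwarz)
    (hGK : GreenKuboCorrectorForm) (hKL : SnapshotKLLowerBound) :
    Summit.AtomisticToContinuum.FouriersLaw.Theses.BondHeatUncertainty.LinearResponseFTUR := by
  intro ω₂ lam β γ hω hl hβ hγ huniq μ hμ T hT D hD
  intro P C V N hN
  have hW' := hW ω₂ lam β γ hω hl hβ hγ T hT
  have hCS' := hCS ω₂ lam β γ hω hl hβ hγ T hT
  have hGK' := hGK ω₂ lam β γ hω hl hβ hγ huniq μ hμ T hT D hD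
  have hKL' := hKL ω₂ lam β γ hω hl hβ hγ huniq μ hμ T hT
  have hN1 : (0 : ℝ) < (N : ℝ) - 1 := by
    have : (2 : ℝ) ≤ (N : ℝ) := by exact_mod_cast hN
    linarith
  -- the response per bond, for any bond `b`, is the Green–Kubo value `g ≥ 0`
  have key : ∀ b : ℕ, b + 1 < N →
      ∃ g : ℝ, 0 ≤ g ∧ D N / ((N : ℝ) - 1) = g ∧
        ∀ t : ℝ, 0 < t → ∀ K : ℝ, 0 ≤ K →
          (∀ᶠ δ in 𝓝[≠] (0 : ℝ), InformationTheory.klDiv (μ N (T + δ / 2) (T - δ / 2))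
            (Measure.map (fun x : PhaseSpace N => (x.1, -x.2)) (μ N (T + δ / 2) (T - δ / 2))) ≤
            ENNReal.ofReal (K * δ ^ 2)) →
          2 * g ^ 2 * t ^ 2 ≤ V N b t * (g * t / T ^ 2 + K) := by
    intro b hb
    obtain ⟨W, hWs, hWb, hWeq⟩ := hW' N hN b hb
    obtain ⟨hg0, hdyn⟩ := hCS' N hN b hb W hWs hWb hWeq
    have hG := hGK' N hN b hb W hWs hWb hWeq
    refine ⟨_, hg0, hG, ?_⟩
    intro t ht K hK hev
    obtain ⟨hV0, hineq⟩ := hdyn t ht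
    have hk := hKL' N hN b hb W hWs hWb hWeq K hK hev
    refine hineq.trans ?_
    have hV0' : 0 ≤ V N b t := hV0
    gcongr
  refine ⟨?_, ?_⟩
  · obtain ⟨g, hg0, hG, -⟩ := key 0 (by omega)
    have : D N = g * ((N : ℝ) - 1) := (div_eq_iff hN1.ne').mp hG
    rw [this]
    exact mul_nonneg hg0 hN1.le
  · intro b hb t ht K hK hev
    obtain ⟨g, hg0, hG, hb'⟩ := key b hb
    rw [hG]
    exact hb' t ht K hK hev

end Summit.AtomisticToContinuum.FouriersLaw.Cruxes.LinearResponseFTUR.SketchIdeator1
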